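import Summits.AtomisticToContinuum.BoseEinsteinCondensation.Theses.BECStronglyRayleigh
import Summits.AtomisticToContinuum.BoseEinsteinCondensation.Theorems.InsertionFieldDelocalisation.Negative.Toolkit
import Literature.Probability.LatticeModels.LatticeGreenFunction
import Literature.Probability.LatticeModels.TorusFourierProofs
import Literature.Probability.LatticeModels.LroInfraredBound
import HarnessLib

/-!
# The discrete Newtonian potential on the torus: stub `stub_greenIdentities` (G12) of line
# `log-insertion-infrared-bound` for crux `InsertionFieldDelocalisation` (stmt-AtomisticToContinuum-9673)

Stub G12 of the skeleton `Cruxes/InsertionFieldDelocalisation` (line `log-insertion-infrared-bound`):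
the deterministic Green-function toolkit of the line. With `G = torusGreen` on `(ℤ/Lℤ)^d`
(`G z = L^{-d} ∑_{k ≠ 0} cos (p_k · z) / ε(p_k)`, `ε(p) = ∑ᵢ (1 - cos pᵢ)`, file
`Literature/Probability/LatticeModels/LatticeGreenFunction.lean`) and `eᵢ = Pi.single i 1`:

* `g12_laplace_torusGreen` : `∑ᵢ [G (z + eᵢ) + G (z - eᵢ) - 2 G z] = -2 ([z = 0] - L^{-d})`
  (`G/2` inverts `-Δ` on mean-zero functions);
* `g12_sum_torusGreen` : `∑_z G z = 0` (the zero mode is removed);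
* `g12_representation` : `g x - L^{-d} ∑ g = ½ ∑ᵢ ∑_y [G (x - y - eᵢ) - G (x - y)] (g (y + eᵢ) - g y)`
  (every function is its mean plus the convolution of its forward gradient with `∇G`);
* `g12_gradient_sq` : `∑ᵢ ∑_y (G y - G (y - eᵢ))² = 2 G 0` (Parseval for the kernel);
* `stub_greenIdentities` : the registered conjunction of the last two for `d = 3`, `L ≥ 2`
  (the hypothesis `2 ≤ L` is not used: the identities hold for every `L ≥ 1`).

Proof. Write `G = Re U`, `U = 𝓕⁻¹ĝ`, `ĝ k = 1_{k ≠ 0} / ε(p_k)` (`torusGreen_eq_torusFourierInv_re`).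
For a character `χ_k`, `χ_k (z ± eᵢ) = χ_k z · e(±kᵢ)` and `e(kᵢ) + e(-kᵢ) = 2 cos p_k,i`, so the torus
Laplacian acts on `𝓕⁻¹c` as the Fourier multiplier `-2ε(p_k)` (`g12_laplace_torusFourierInv`); on `ĝ`
this multiplier gives `1_{k ≠ 0}`, whose inverse transform is `[z = 0] - L^{-d}` by orthogonality of
characters (`sum_torusChar_left`). The representation formula and the kernel Parseval identity then
follow by summation by parts on the finite abelian group `(ℤ/Lℤ)^d` (reindexing `y ↦ y + eᵢ`).
-/

noncomputable section

open scoped BigOperators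
open Literature.MathematicalPhysics.QuantumLattice Literature.Probability.LatticeModels
open Summit.AtomisticToContinuum.BoseEinsteinCondensation.Theorems.InsertionFieldDelocalisation.Negative

set_option linter.dupNamespace false

namespace Summit.AtomisticToContinuum.BoseEinsteinCondensation.Cruxes.InsertionFieldDelocalisation.LogInsertionInfraredBound

open scoped ComplexConjugate

section GeneralDimension

variable {d L : ℕ} [NeZero L]

/-! ### Characters at unit vectors and the Fourier symbol of the torus Laplacian -/

/-- A character at a unit vector: `χ_k(eᵢ) = e(kᵢ)`. -/
theorem g12_torusChar_single (k : TorusSite d L) (i : Fin d) :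
    torusChar k (Pi.single i 1) = (ZMod.stdAddChar (k i) : ℂ) := by
  rw [torusChar, Finset.prod_eq_single i (fun j _ hj => by simp [Pi.single_eq_of_ne hj]) (by simp)]
  simp

/-- The real part of the standard additive character: `Re e(a) = cos (2π a.val / L)`. -/
theorem g12_stdAddChar_re (a : ZMod L) :
    (ZMod.stdAddChar a : ℂ).re = Real.cos (2 * Real.pi * (a.val : ℝ) / L) := by
  rw [ZMod.stdAddChar_apply, ZMod.toCircle_apply]
  have h : (2 * (Real.pi : ℂ) * Complex.I * (a.val : ℂ) / (L : ℂ)) =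
      ((2 * Real.pi * (a.val : ℝ) / L : ℝ) : ℂ) * Complex.I := by
    push_cast
    ring
  rw [h, Complex.exp_ofReal_mul_I_re]

/-- `Re χ_k(eᵢ) = cos p_k,i` with `p_k = latticeMomentum L k`. -/
theorem g12_torusChar_single_re (k : TorusSite d L) (i : Fin d) :
    (torusChar k (Pi.single i 1)).re = Real.cos (latticeMomentum L k i) := by
  rw [g12_torusChar_single, g12_stdAddChar_re]
  rfl

/-- **The torus Laplacian of a character**:
`∑ᵢ [χ_k(z + eᵢ) + χ_k(z - eᵢ) - 2χ_k(z)] = -2 ε(p_k) χ_k(z)`. -/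
theorem g12_sum_torusChar_laplace (k z : TorusSite d L) :
    ∑ i, (torusChar k (z + Pi.single i 1) + torusChar k (z - Pi.single i 1) - 2 * torusChar k z) =
      -2 * (dispersion (latticeMomentum L k) : ℂ) * torusChar k z := by
  have h : ∀ i : Fin d, torusChar k (z + Pi.single i 1) + torusChar k (z - Pi.single i 1) -
      2 * torusChar k z = ((2 * Real.cos (latticeMomentum L k i) - 2 : ℝ) : ℂ) * torusChar k z := by
    intro i
    have hc : torusChar k (Pi.single i 1) + conj (torusChar k (Pi.single i 1)) =
        ((2 * Real.cos (latticeMomentum L k i) : ℝ) : ℂ) := by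
      rw [Complex.add_conj, g12_torusChar_single_re]
    rw [torusChar_add_right, torusChar_sub_right, Complex.ofReal_sub, ← hc]
    push_cast
    ring
  simp_rw [h]
  rw [← Finset.sum_mul]
  congr 1
  rw [← Complex.ofReal_sum, dispersion]
  have hs : ∑ i, (2 * Real.cos (latticeMomentum L k i) - 2) =
      -2 * ∑ i, (1 - Real.cos (latticeMomentum L k i)) := by
    rw [Finset.mul_sum]
    exact Finset.sum_congr rfl fun i _ => by ring
  rw [hs, Complex.ofReal_mul, Complex.ofReal_neg, Complex.ofReal_ofNat]

/-- **The torus Laplacian is the Fourier multiplier `-2ε`**: for every `c : (ℤ/Lℤ)^d → ℂ`,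
`∑ᵢ [𝓕⁻¹c (z + eᵢ) + 𝓕⁻¹c (z - eᵢ) - 2 𝓕⁻¹c (z)] = -2 𝓕⁻¹(ε · c)(z)`. -/
theorem g12_laplace_torusFourierInv (c : TorusSite d L → ℂ) (z : TorusSite d L) :
    ∑ i, (torusFourierInv c (z + Pi.single i 1) + torusFourierInv c (z - Pi.single i 1) -
        2 * torusFourierInv c z) =
      -2 * torusFourierInv (fun k => (dispersion (latticeMomentum L k) : ℂ) * c k) z := by
  simp only [torusFourierInv_eq_sum_torusChar]
  calc ∑ i, (((L : ℂ) ^ d)⁻¹ * ∑ k, c k * torusChar k (z + Pi.single i 1) +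
          ((L : ℂ) ^ d)⁻¹ * ∑ k, c k * torusChar k (z - Pi.single i 1) -
          2 * (((L : ℂ) ^ d)⁻¹ * ∑ k, c k * torusChar k z))
      = ∑ i : Fin d, ((L : ℂ) ^ d)⁻¹ * ∑ k, c k *
          (torusChar k (z + Pi.single i 1) + torusChar k (z - Pi.single i 1) -
            2 * torusChar k z) := by
        refine Finset.sum_congr rfl fun i _ => ?_
        simp only [Finset.mul_sum, ← Finset.sum_add_distrib, ← Finset.sum_sub_distrib]
        exact Finset.sum_congr rfl fun k _ => by ring
    _ = ((L : ℂ) ^ d)⁻¹ * ∑ k, c k * ∑ i : Fin d,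
          (torusChar k (z + Pi.single i 1) + torusChar k (z - Pi.single i 1) -
            2 * torusChar k z) := by
        rw [← Finset.mul_sum, Finset.sum_comm]
        congr 1
        exact Finset.sum_congr rfl fun k _ => by rw [Finset.mul_sum]
    _ = -2 * (((L : ℂ) ^ d)⁻¹ * ∑ k, (dispersion (latticeMomentum L k) : ℂ) * c k *
          torusChar k z) := by
        simp_rw [g12_sum_torusChar_laplace]
        simp only [Finset.mul_sum]
        exact Finset.sum_congr rfl fun k _ => by ring

/-- The multiplier `ε` applied to the symbol `1_{k ≠ 0}/ε(p_k)` of the torus Green function is the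
indicator of the nonzero modes. -/
theorem g12_dispersion_mul_symbol :
    (fun k : TorusSite d L => (dispersion (latticeMomentum L k) : ℂ) *
      (if k = 0 then (0 : ℂ) else ((dispersion (latticeMomentum L k))⁻¹ : ℝ))) =
      fun k => if k = 0 then (0 : ℂ) else 1 := by
  funext k
  split_ifs with hk
  · simp
  · have hne : dispersion (latticeMomentum L k) ≠ 0 := fun h =>
      hk ((dispersion_latticeMomentum_eq_zero_iff_holds k).1 h)
    push_cast
    exact mul_inv_cancel₀ (Complex.ofReal_ne_zero.2 hne)

/-- The inverse transform of the indicator of the nonzero modes: `𝓕⁻¹(1_{k ≠ 0})(z) = [z = 0] - L^{-d}`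
(orthogonality of characters). -/
theorem g12_torusFourierInv_indicator (z : TorusSite d L) :
    torusFourierInv (fun k : TorusSite d L => if k = 0 then (0 : ℂ) else 1) z =
      (((if z = 0 then (1 : ℝ) else 0) - ((L : ℝ) ^ d)⁻¹ : ℝ) : ℂ) := by
  rw [torusFourierInv_eq_sum_torusChar]
  have h : ∑ k : TorusSite d L, (if k = 0 then (0 : ℂ) else 1) * torusChar k z =
      ∑ k, torusChar k z - 1 := by
    have h1 : ∀ k : TorusSite d L, (if k = 0 then (0 : ℂ) else 1) * torusChar k z =
        torusChar k z - (if k = 0 then torusChar k z else 0) := by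
      intro k
      split_ifs <;> simp
    simp_rw [h1]
    rw [Finset.sum_sub_distrib, Finset.sum_ite_eq']
    simp
  rw [h, sum_torusChar_left]
  have hL : ((L : ℂ) ^ d) ≠ 0 := natCast_pow_ne_zero
  split_ifs
  · push_cast
    rw [mul_sub, inv_mul_cancel₀ hL, mul_one]
  · push_cast
    ring

/-- The zero mode of an inverse transform: `∑_z 𝓕⁻¹c (z) = c 0`. -/
theorem g12_sum_torusFourierInv (c : TorusSite d L → ℂ) :
    ∑ z, torusFourierInv c z = c 0 := by
  simp_rw [torusFourierInv_eq_sum_torusChar]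
  rw [← Finset.mul_sum, Finset.sum_comm]
  simp_rw [← Finset.mul_sum, sum_torusChar_right, mul_ite, mul_zero]
  rw [Finset.sum_ite_eq']
  simp only [Finset.mem_univ, if_true]
  have hL : ((L : ℂ) ^ d) ≠ 0 := natCast_pow_ne_zero
  field_simp

/-! ### The torus Green function: Laplacian, zero mode, representation, Parseval -/

/-- **`G/2` inverts `-Δ` on mean-zero functions**:
`∑ᵢ [G (z + eᵢ) + G (z - eᵢ) - 2 G z] = -2 ([z = 0] - L^{-d})` for `G = torusGreen`. -/
theorem g12_laplace_torusGreen (z : TorusSite d L) :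
    ∑ i, (torusGreen (z + Pi.single i 1) + torusGreen (z - Pi.single i 1) - 2 * torusGreen z) =
      -2 * ((if z = 0 then (1 : ℝ) else 0) - ((L : ℝ) ^ d)⁻¹) := by
  simp_rw [torusGreen_eq_torusFourierInv_re]
  have h := g12_laplace_torusFourierInv (fun k : TorusSite d L =>
    if k = 0 then (0 : ℂ) else ((dispersion (latticeMomentum L k))⁻¹ : ℝ)) z
  rw [g12_dispersion_mul_symbol, g12_torusFourierInv_indicator,
    show (-2 : ℂ) = ((-2 : ℝ) : ℂ) by norm_num, ← Complex.ofReal_mul] at h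
  have h' := congrArg Complex.re h
  rw [Complex.re_sum, Complex.ofReal_re] at h'
  refine Eq.trans (Finset.sum_congr rfl fun i _ => ?_) h'
  simp

/-- **The zero mode is removed**: `∑_z torusGreen z = 0`. -/
theorem g12_sum_torusGreen : ∑ z : TorusSite d L, torusGreen z = 0 := by
  simp_rw [torusGreen_eq_torusFourierInv_re]
  rw [← Complex.re_sum, g12_sum_torusFourierInv]
  simp

/-- **Discrete Newtonian-potential representation** on `(ℤ/Lℤ)^d`: every real function is its mean
plus the convolution of its forward gradient with the gradient of the torus Green function,
`g x - L^{-d} ∑ g = ½ ∑ᵢ ∑_y [G (x - y - eᵢ) - G (x - y)] (g (y + eᵢ) - g y)`. -/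
theorem g12_representation (g : TorusSite d L → ℝ) (x : TorusSite d L) :
    g x - (∑ y, g y) / (L : ℝ) ^ d =
      (1 / 2 : ℝ) * ∑ i : Fin d, ∑ y : TorusSite d L,
        (torusGreen (x - y - Pi.single i 1) - torusGreen (x - y)) * (g (y + Pi.single i 1) - g y) := by
  have h1 : ∀ i : Fin d, ∑ y : TorusSite d L,
      (torusGreen (x - y - Pi.single i 1) - torusGreen (x - y)) * (g (y + Pi.single i 1) - g y) =
      -∑ y, (torusGreen (x - y + Pi.single i 1) + torusGreen (x - y - Pi.single i 1) -
        2 * torusGreen (x - y)) * g y := by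
    intro i
    set e : TorusSite d L := Pi.single i 1
    have hshift : ∑ y, (torusGreen (x - y - e) - torusGreen (x - y)) * g (y + e) =
        ∑ y, (torusGreen (x - y) - torusGreen (x - y + e)) * g y := by
      refine Fintype.sum_equiv (Equiv.addRight e) _ _ fun y => ?_
      simp only [Equiv.coe_addRight, sub_add_eq_sub_sub, sub_add_cancel]
    calc ∑ y, (torusGreen (x - y - e) - torusGreen (x - y)) * (g (y + e) - g y)
        = ∑ y, ((torusGreen (x - y - e) - torusGreen (x - y)) * g (y + e) -
            (torusGreen (x - y - e) - torusGreen (x - y)) * g y) :=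
          Finset.sum_congr rfl fun y _ => by ring
      _ = ∑ y, (torusGreen (x - y) - torusGreen (x - y + e)) * g y -
            ∑ y, (torusGreen (x - y - e) - torusGreen (x - y)) * g y := by
          rw [Finset.sum_sub_distrib, hshift]
      _ = -∑ y, (torusGreen (x - y + e) + torusGreen (x - y - e) - 2 * torusGreen (x - y)) * g y := by
          rw [← Finset.sum_sub_distrib, ← Finset.sum_neg_distrib]
          exact Finset.sum_congr rfl fun y _ => by ring
  simp_rw [h1]
  rw [Finset.sum_neg_distrib, Finset.sum_comm]
  simp_rw [← Finset.sum_mul, g12_laplace_torusGreen, sub_eq_zero]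
  have h2 : ∀ y, -2 * ((if x = y then (1 : ℝ) else 0) - ((L : ℝ) ^ d)⁻¹) * g y =
      -2 * (if x = y then g y else 0) + 2 * ((L : ℝ) ^ d)⁻¹ * g y := by
    intro y
    split_ifs <;> ring
  simp_rw [h2]
  rw [Finset.sum_add_distrib, ← Finset.mul_sum, ← Finset.mul_sum, Finset.sum_ite_eq]
  simp only [Finset.mem_univ, if_true]
  ring

/-- **Parseval for the kernel**: `∑ᵢ ∑_y (G y - G (y - eᵢ))² = 2 G 0` for `G = torusGreen`
(summation by parts, `g12_laplace_torusGreen` and `g12_sum_torusGreen`). -/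
theorem g12_gradient_sq :
    ∑ i : Fin d, ∑ y : TorusSite d L, (torusGreen y - torusGreen (y - Pi.single i 1)) ^ 2 =
      2 * torusGreen (0 : TorusSite d L) := by
  have h1 : ∀ i : Fin d, ∑ y : TorusSite d L, (torusGreen y - torusGreen (y - Pi.single i 1)) ^ 2 =
      -∑ y : TorusSite d L, torusGreen y *
        (torusGreen (y + Pi.single i 1) + torusGreen (y - Pi.single i 1) - 2 * torusGreen y) := by
    intro i
    set e : TorusSite d L := Pi.single i 1
    have hshift : ∑ y, torusGreen y * (torusGreen (y + e) - torusGreen y) =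
        ∑ y, torusGreen (y - e) * (torusGreen y - torusGreen (y - e)) := by
      refine Fintype.sum_equiv (Equiv.addRight e) _ _ fun y => ?_
      simp only [Equiv.coe_addRight, add_sub_cancel_right]
    calc ∑ y, (torusGreen y - torusGreen (y - e)) ^ 2
        = ∑ y, (torusGreen y * (torusGreen y - torusGreen (y - e)) -
            torusGreen (y - e) * (torusGreen y - torusGreen (y - e))) :=
          Finset.sum_congr rfl fun y _ => by ring
      _ = ∑ y, torusGreen y * (torusGreen y - torusGreen (y - e)) -
            ∑ y, torusGreen y * (torusGreen (y + e) - torusGreen y) := by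
          rw [Finset.sum_sub_distrib, hshift]
      _ = -∑ y, torusGreen y * (torusGreen (y + e) + torusGreen (y - e) - 2 * torusGreen y) := by
          rw [← Finset.sum_sub_distrib, ← Finset.sum_neg_distrib]
          exact Finset.sum_congr rfl fun y _ => by ring
  simp_rw [h1]
  rw [Finset.sum_neg_distrib, Finset.sum_comm]
  simp_rw [← Finset.mul_sum, g12_laplace_torusGreen]
  have h2 : ∀ y : TorusSite d L,
      torusGreen y * (-2 * ((if y = 0 then (1 : ℝ) else 0) - ((L : ℝ) ^ d)⁻¹)) =
      -2 * (if y = 0 then torusGreen y else 0) + 2 * ((L : ℝ) ^ d)⁻¹ * torusGreen y := by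
    intro y
    split_ifs <;> ring
  simp_rw [h2]
  rw [Finset.sum_add_distrib, ← Finset.mul_sum, ← Finset.mul_sum, Finset.sum_ite_eq',
    g12_sum_torusGreen]
  simp only [Finset.mem_univ, if_true]
  ring

end GeneralDimension

/-! ### The registered stub (d = 3) -/

/-- **G12 · `stub_greenIdentities`.** The Newtonian-potential representation and the kernel
Parseval identity on `(ℤ/Lℤ)³`, `L ≥ 2` (both follow from `Δ_z cos(p_k·z) = −2ε(p_k)cos(p_k·z)` with the `.val` phases
of `torusGreen`, character orthogonality `Σ_k cos(p_k·z) = L³δ_{z,0}` / `Σ_z cos(p_k·z) = L³δ_{k,0}`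
(`sum_torusChar_left/right`, `torusChar_re`, `torusGreen_eq_torusFourierInv_re`), and summation by parts on the torus);
the hypothesis `2 ≤ L` is not needed (`g12_representation`, `g12_gradient_sq` hold for every `L ≥ 1`). -/
theorem stub_greenIdentities :
    ∀ (L : ℕ) [NeZero L], 2 ≤ L →
      (∀ (g : TorusSite 3 L → ℝ) (x : TorusSite 3 L),
        g x - (∑ y, g y) / (L : ℝ) ^ 3 =
          (1 / 2 : ℝ) * ∑ i : Fin 3, ∑ y : TorusSite 3 L,
            (torusGreen (x - y - Pi.single i 1) - torusGreen (x - y)) * (g (y + Pi.single i 1) - g y)) ∧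
      (∑ i : Fin 3, ∑ y : TorusSite 3 L, (torusGreen y - torusGreen (y - Pi.single i 1)) ^ 2 =
        2 * torusGreen (0 : TorusSite 3 L)) := by
  intro L _ _
  exact ⟨fun g x => g12_representation g x, g12_gradient_sq⟩

end Summit.AtomisticToContinuum.BoseEinsteinCondensation.Cruxes.InsertionFieldDelocalisation.LogInsertionInfraredBound
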